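import Literature.AlgebraicGeometry.Hu2025.Statements.S05ThetaBlowups.R106aCharts
import Mathlib.Tactic.FinCases
import Mathlib.Tactic.Ring
/-!
# Hu 2025 (arXiv:2507.21400v1) §5.1 — KERNEL DISCHARGE of the three typed claims of row 106a (I-CH):
# `Def5_1`, `Prop5_3`, `Lem5_5` hold AS TYPED, for every commutative ring `R`, every index type `V`, every step `s`.

M-HU PREP by res-type-023 (gen 8), 2026-08-27 — FILED by res-type-023 (gen 9) as row-106 owner per the M-Hu re-pointing line 2026-08-27T08:00:07Z (director-resolution g4, M-Hu-min OPEN); S file R106aCharts = p513406; T9: every locator re-read on the chunks in this seat 2026-08-27T05:4xZ; pre-drafts g4–g9 under HOME/plan/tools/res-type-023/hu/ (target after `S05ThetaBlowups/R106aCharts.lean` lands: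
`Literature/AlgebraicGeometry/Hu2025/Proofs/S05ThetaBlowups/Charts.lean`, kind proof). Nothing of [Hu25] is asserted: these are
theorems about OUR typed carriers (`ChartStep.pullback`, `ChartStep.strictTransform`, `ChartStep.properTransform`), certifying that
the I-CH vocabulary computes what Def. 5.1 / Prop. 5.3 / Lem. 5.5 print (C34L69–C35L63; p.79–81). AI work, weaker than expert review.

* `Def5_1_holds`  — `π^*(y'_0,…,y'_m)·R[Var_𝔙] = (ζ)` (C34L81 «𝔙 = (𝔙' × (ξ_i ≡ 1)) ∩ X̃», Prop. 5.3 • «E ∩ 𝔙 = (ζ = 0)»).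
* `Prop5_3_holds` — the three bullets of Prop. 5.3 (C34L146–C35L4): with «proper transform of the divisor» = strict transform of its
  ideal (OURS vocabulary), `(X_{y_i}) = strict((X_{y'_i}))` for `i ∈ [m]` and `(X_y) = strict((X_{y'}))` for `y' ∉ φ` — printed proof
  C35L6–L8 «straightforward from (general-blowup-formulas)»; the kernel route is `X_j ∤`-cancellation of powers of `ζ` (any `R`).
* `Lem5_5_holds`  — Lem. 5.5 (C35L51–L59): for `y ∈ Var_𝔙 ∖ ζ`, `y^b ∣ T_𝔙 ↔ y^b ∣ T_𝔙'` — on exponent vectors the Def. 5.4 operation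
  changes only the `ζ`-exponent (printed proof C35L61–L63 «clear from Definition (general-proper-transforms)»).
-/

noncomputable section

open MvPolynomial

namespace Literature.AlgebraicGeometry.Hu2025.Statements.S05ThetaBlowups

universe u v

variable {R : Type u} [CommRing R] {V : Type v}

/-! ## `X_j`-divisibility is insensitive to powers of another variable (any commutative ring) -/

/-- `X_j ∣ x` iff every monomial in the support of `x` has positive `j`-exponent (coefficient form).
[cite: Hu2025, §5.1 Def. 5.1–5.6 / Prop. 5.3 / Lem. 5.5, pp. 79–81 (unrefereed preprint arXiv:2507.21400v1 under adjudication, D-0012/D-0089 — kernel support on OUR typed carrier of row 106; nothing of the source asserted)] -/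
theorem X_dvd_iff_coeff_eq_zero {j : V} {x : MvPolynomial V R} :
    X j ∣ x ↔ ∀ m : V →₀ ℕ, m j = 0 → coeff m x = 0 := by
  rw [X_dvd_iff_modMonomial_eq_zero, MvPolynomial.ext_iff]
  refine forall_congr' fun m => ?_
  by_cases h : Finsupp.single j 1 ≤ m
  · rw [coeff_modMonomial_of_le _ h, coeff_zero]
    have hj : m j ≠ 0 := by
      rw [Finsupp.single_le_iff] at h
      omega
    exact ⟨fun _ hm => (hj hm).elim, fun _ => rfl⟩
  · rw [coeff_modMonomial_of_not_le _ h, coeff_zero]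
    have hj : m j = 0 := by
      rw [Finsupp.single_le_iff] at h
      omega
    exact ⟨fun h' _ => h', fun h' => h' hj⟩

/-- `X_j ∣ g · X_i ⟹ X_j ∣ g` for `i ≠ j`, over ANY commutative ring.
[cite: Hu2025, §5.1 Def. 5.1–5.6 / Prop. 5.3 / Lem. 5.5, pp. 79–81 (unrefereed preprint arXiv:2507.21400v1 under adjudication, D-0012/D-0089 — kernel support on OUR typed carrier of row 106; nothing of the source asserted)] -/
theorem dvd_of_X_dvd_mul_X {i j : V} (hij : i ≠ j) {g : MvPolynomial V R} (h : X j ∣ g * X i) : X j ∣ g := by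
  rw [X_dvd_iff_coeff_eq_zero] at h ⊢
  intro m hm
  have h' := h (Finsupp.single i 1 + m) (by simp [Finsupp.add_apply, hm, hij])
  rwa [mul_comm, coeff_X_mul] at h'

/-- `X_j ∣ g · X_i ^ n ⟹ X_j ∣ g` for `i ≠ j`, over ANY commutative ring.
[cite: Hu2025, §5.1 Def. 5.1–5.6 / Prop. 5.3 / Lem. 5.5, pp. 79–81 (unrefereed preprint arXiv:2507.21400v1 under adjudication, D-0012/D-0089 — kernel support on OUR typed carrier of row 106; nothing of the source asserted)] -/
theorem dvd_of_X_dvd_mul_X_pow {i j : V} (hij : i ≠ j) (n : ℕ) {g : MvPolynomial V R} (h : X j ∣ g * X i ^ n) :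
    X j ∣ g := by
  induction n generalizing g with
  | zero => simpa using h
  | succ n ih =>
    apply ih
    apply dvd_of_X_dvd_mul_X hij
    rwa [mul_assoc, ← pow_succ]

/-- Ideal form: `g · X_i ^ n ∈ (X_j) ⟹ g ∈ (X_j)` for `i ≠ j`.
[cite: Hu2025, §5.1 Def. 5.1–5.6 / Prop. 5.3 / Lem. 5.5, pp. 79–81 (unrefereed preprint arXiv:2507.21400v1 under adjudication, D-0012/D-0089 — kernel support on OUR typed carrier of row 106; nothing of the source asserted)] -/
theorem mem_span_X_of_mul_X_pow_mem {i j : V} (hij : i ≠ j) (n : ℕ) {g : MvPolynomial V R}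
    (h : g * X i ^ n ∈ Ideal.span ({X j} : Set (MvPolynomial V R))) : g ∈ Ideal.span ({X j} : Set (MvPolynomial V R)) := by
  rw [Ideal.mem_span_singleton] at h ⊢
  exact dvd_of_X_dvd_mul_X_pow hij n h

/-- A `z`-saturated ideal equals the union of its colons by the powers of `z`.
[cite: Hu2025, §5.1 Def. 5.1–5.6 / Prop. 5.3 / Lem. 5.5, pp. 79–81 (unrefereed preprint arXiv:2507.21400v1 under adjudication, D-0012/D-0089 — kernel support on OUR typed carrier of row 106; nothing of the source asserted)] -/
theorem iSup_colon_pow_eq_self {A : Type u} [CommRing A] (J : Ideal A) (z : A)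
    (hJ : ∀ (n : ℕ) (f : A), f * z ^ n ∈ J → f ∈ J) :
    (⨆ n : ℕ, J.colon ({z ^ n} : Set A)) = J := by
  apply le_antisymm
  · exact iSup_le fun n f hf => hJ n f (by
      rw [Submodule.mem_colon_singleton, smul_eq_mul] at hf
      exact hf)
  · intro f hf
    exact (le_iSup (fun n : ℕ => J.colon ({z ^ n} : Set A)) 0) (by
      rw [Submodule.mem_colon_singleton, smul_eq_mul, pow_zero, mul_one]
      exact hf)

variable [DecidableEq V]

namespace ChartStep

variable (s : ChartStep V)

/-! ## The pull-back on variables (Def. 5.4 substitution, C35L26–L29) -/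

/-- The pull-back on a variable, by cases (Def. 5.4 substitution C35L26–L29): `ζ·x_j` on the centre's non-exceptional indices, identity elsewhere. [cite: Hu2025, §5.1 Def. 5.1–5.6 / Prop. 5.3 / Lem. 5.5, pp. 79–81 (unrefereed preprint arXiv:2507.21400v1 under adjudication, D-0012/D-0089 — kernel support on OUR typed carrier of row 106; nothing of the source asserted)] -/
theorem pullback_X (j : V) :
    s.pullback (R := R) (X j) = if j ∈ s.centre ∧ j ≠ s.exc then X s.exc * X j else X j := by
  simp [pullback]

/-- `π^* ζ = ζ` (`y'_0 ↦ ζ`).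
[cite: Hu2025, §5.1 Def. 5.1–5.6 / Prop. 5.3 / Lem. 5.5, pp. 79–81 (unrefereed preprint arXiv:2507.21400v1 under adjudication, D-0012/D-0089 — kernel support on OUR typed carrier of row 106; nothing of the source asserted)] -/
theorem pullback_X_exc : s.pullback (R := R) (X s.exc) = X s.exc := by
  simp [pullback_X]

/-- `π^* y'_j = ζ · y_j` for `j ∈ φ ∖ {i}`.
[cite: Hu2025, §5.1 Def. 5.1–5.6 / Prop. 5.3 / Lem. 5.5, pp. 79–81 (unrefereed preprint arXiv:2507.21400v1 under adjudication, D-0012/D-0089 — kernel support on OUR typed carrier of row 106; nothing of the source asserted)] -/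
theorem pullback_X_of_mem {j : V} (hj : j ∈ s.centre) (hne : j ≠ s.exc) :
    s.pullback (R := R) (X j) = X s.exc * X j := by
  simp [pullback_X, hj, hne]

/-- `π^* y' = y` for `y' ∉ φ`.
[cite: Hu2025, §5.1 Def. 5.1–5.6 / Prop. 5.3 / Lem. 5.5, pp. 79–81 (unrefereed preprint arXiv:2507.21400v1 under adjudication, D-0012/D-0089 — kernel support on OUR typed carrier of row 106; nothing of the source asserted)] -/
theorem pullback_X_of_not_mem {y : V} (hy : y ∉ s.centre) : s.pullback (R := R) (X y) = X y := by
  simp [pullback_X, hy]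

omit [DecidableEq V] in
/-- `ζ` is the variable of index `exc`. [cite: Hu2025, §5.1 Def. 5.1–5.6 / Prop. 5.3 / Lem. 5.5, pp. 79–81 (unrefereed preprint arXiv:2507.21400v1 under adjudication, D-0012/D-0089 — kernel support on OUR typed carrier of row 106; nothing of the source asserted)] -/
theorem excVar_eq : s.excVar (R := R) = X s.exc := rfl

/-! ## Strict transforms of the coordinate hyperplanes -/

/-- `strict((X_{y'})) = (X_y)` for `y' ∉ φ` (Prop. 5.3, third bullet).
[cite: Hu2025, §5.1 Def. 5.1–5.6 / Prop. 5.3 / Lem. 5.5, pp. 79–81 (unrefereed preprint arXiv:2507.21400v1 under adjudication, D-0012/D-0089 — kernel support on OUR typed carrier of row 106; nothing of the source asserted)] -/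
theorem strictTransform_span_X_of_not_mem {y : V} (hy : y ∉ s.centre) :
    s.strictTransform (R := R) (Ideal.span {X y}) = Ideal.span {X y} := by
  have hne : s.exc ≠ y := fun h => hy (h ▸ s.exc_mem)
  unfold strictTransform
  rw [Ideal.map_span, Set.image_singleton, pullback_X_of_not_mem s hy, excVar_eq]
  exact iSup_colon_pow_eq_self _ _ fun n f hf => mem_span_X_of_mul_X_pow_mem hne n hf

/-- `strict((X_{y'_j})) = (X_{y_j})` for `j ∈ φ ∖ {i}` (Prop. 5.3, second bullet): `π^*(X_{y'_j}) = (ζ X_j)` and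
`(ζ X_j : ζ^∞) = (X_j)`.
[cite: Hu2025, §5.1 Def. 5.1–5.6 / Prop. 5.3 / Lem. 5.5, pp. 79–81 (unrefereed preprint arXiv:2507.21400v1 under adjudication, D-0012/D-0089 — kernel support on OUR typed carrier of row 106; nothing of the source asserted)] -/
theorem strictTransform_span_X_of_mem {j : V} (hj : j ∈ s.centre) (hne : j ≠ s.exc) :
    s.strictTransform (R := R) (Ideal.span {X j}) = Ideal.span {X j} := by
  unfold strictTransform
  rw [Ideal.map_span, Set.image_singleton, pullback_X_of_mem s hj hne, excVar_eq]
  apply le_antisymm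
  · refine iSup_le fun n f hf => ?_
    rw [Submodule.mem_colon_singleton, smul_eq_mul] at hf
    have hle : Ideal.span ({X s.exc * X j} : Set (MvPolynomial V R)) ≤ Ideal.span {X j} :=
      Ideal.span_le.mpr (Set.singleton_subset_iff.mpr
        (Ideal.mul_mem_left _ _ (Ideal.subset_span (Set.mem_singleton _))))
    have hf' : f * X s.exc ^ n ∈ Ideal.span ({X j} : Set (MvPolynomial V R)) := hle hf
    exact mem_span_X_of_mul_X_pow_mem (Ne.symm hne) n hf'
  · intro f hf
    refine (le_iSup (fun n : ℕ => (Ideal.span ({X s.exc * X j} : Set (MvPolynomial V R))).colon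
      ({X s.exc ^ n} : Set (MvPolynomial V R))) 1) ?_
    rw [Submodule.mem_colon_singleton, smul_eq_mul, pow_one]
    obtain ⟨a, rfl⟩ := Ideal.mem_span_singleton'.mp hf
    have : a * X j * X s.exc = a * (X s.exc * X j) := by ring
    rw [this]
    exact Ideal.mul_mem_left _ _ (Ideal.subset_span (Set.mem_singleton _))

/-! ## Def. 5.4 on exponents: only the `ζ`-exponent moves -/

/-- The term-wise proper transform does not change the exponent of a non-exceptional variable in the plus term (Lem. 5.5, C35L51–L59). [cite: Hu2025, §5.1 Def. 5.1–5.6 / Prop. 5.3 / Lem. 5.5, pp. 79–81 (unrefereed preprint arXiv:2507.21400v1 under adjudication, D-0012/D-0089 — kernel support on OUR typed carrier of row 106; nothing of the source asserted)] -/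
theorem properTransform_plus_apply_of_ne (B : Binomial V) {y : V} (hy : y ≠ s.exc) :
    (s.properTransform B).plus y = B.plus y := by
  simp [properTransform, pullbackExp, Ne.symm hy]

/-- The term-wise proper transform does not change the exponent of a non-exceptional variable in the minus term (Lem. 5.5, C35L51–L59). [cite: Hu2025, §5.1 Def. 5.1–5.6 / Prop. 5.3 / Lem. 5.5, pp. 79–81 (unrefereed preprint arXiv:2507.21400v1 under adjudication, D-0012/D-0089 — kernel support on OUR typed carrier of row 106; nothing of the source asserted)] -/
theorem properTransform_minus_apply_of_ne (B : Binomial V) {y : V} (hy : y ≠ s.exc) :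
    (s.properTransform B).minus y = B.minus y := by
  simp [properTransform, pullbackExp, Ne.symm hy]

end ChartStep

/-! ## The three claims of row 106a, discharged -/

variable (R)

/-- **Def. 5.1 / Prop. 5.3 first bullet AS TYPED holds:** `π^*(y'_0,…,y'_m) · R[Var_𝔙] = (ζ)` for every step.
[cite: Hu2025, §5.1 Def. 5.1–5.6 / Prop. 5.3 / Lem. 5.5, pp. 79–81 (unrefereed preprint arXiv:2507.21400v1 under adjudication, D-0012/D-0089 — kernel support on OUR typed carrier of row 106; nothing of the source asserted)] -/
theorem Def5_1_holds (s : ChartStep V) : Def5_1 R s := by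
  unfold Def5_1
  rw [Ideal.map_span, ChartStep.excVar_eq]
  apply le_antisymm
  · refine Ideal.span_le.mpr ?_
    rintro _ ⟨_, ⟨j, hj, rfl⟩, rfl⟩
    by_cases hje : j = s.exc
    · subst hje
      rw [ChartStep.pullback_X_exc]
      exact Ideal.subset_span (Set.mem_singleton _)
    · rw [ChartStep.pullback_X_of_mem s hj hje]
      exact Ideal.mul_mem_right _ _ (Ideal.subset_span (Set.mem_singleton _))
  · refine Ideal.span_le.mpr (Set.singleton_subset_iff.mpr (Ideal.subset_span ?_))
    exact ⟨X s.exc, ⟨s.exc, s.exc_mem, rfl⟩, ChartStep.pullback_X_exc s⟩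

/-- **Prop. 5.3 AS TYPED holds** (all three bullets, every `R`, `V`, `s`).
[cite: Hu2025, §5.1 Def. 5.1–5.6 / Prop. 5.3 / Lem. 5.5, pp. 79–81 (unrefereed preprint arXiv:2507.21400v1 under adjudication, D-0012/D-0089 — kernel support on OUR typed carrier of row 106; nothing of the source asserted)] -/
theorem Prop5_3_holds (s : ChartStep V) : Prop5_3 R s := by
  refine ⟨Def5_1_holds R s, fun j hj hne => ?_, fun y hy => ?_⟩
  · exact (ChartStep.strictTransform_span_X_of_mem s hj hne).symm
  · exact (ChartStep.strictTransform_span_X_of_not_mem s hy).symm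

/-- **Lem. 5.5 AS TYPED holds** (every `R`, `V`, `s`, `B`).
[cite: Hu2025, §5.1 Def. 5.1–5.6 / Prop. 5.3 / Lem. 5.5, pp. 79–81 (unrefereed preprint arXiv:2507.21400v1 under adjudication, D-0012/D-0089 — kernel support on OUR typed carrier of row 106; nothing of the source asserted)] -/
theorem Lem5_5_holds (s : ChartStep V) (B : Binomial V) : Lem5_5 s B := by
  intro y hy b
  rw [ChartStep.properTransform_plus_apply_of_ne s B hy, ChartStep.properTransform_minus_apply_of_ne s B hy]
  exact ⟨Iff.rfl, Iff.rfl⟩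

/-!
## A toy on the typed vocabulary: term-wise proper transforms need not generate the strict transform of the ideal

What joint J3 (G-H2) compares (PARTITION-HU §6 (e)) is, on the abstract vocabulary of row 106a, NOT a formal triviality: for the
step `s` = (centre `{a, b}`, chart `ζ = a`) on `ℤ[a, b, t]` and the two binomials `B₁ = a·t − b²`, `B₂ = t − b`, the term-wise proper
transforms are `t − a·b²` and `t − a·b` (Def. 5.4: `l_{φ,B₁} = 1`, `l_{φ,B₂} = 0`), while `b − b²` lies in the strict transform of the
ideal `(B₁, B₂)` (`a²·(b − b²) = π^*(B₁ − a·B₂)`) but not in `(t − a·b², t − a·b)` (evaluate at `a = t = 0`, `b = 2`). This says nothing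
about [Hu25]'s equations — there the generation is argued from the structure of the governing binomials (Prop. 5.16's proof); it only
records that the inference is about that structure, not about Def. 5.4 alone. OURS toy; nothing of the source asserted.
-/

section GH2Toy

/-- **Toy (OURS): the ideal of the term-wise proper transforms can be strictly smaller than the strict transform of the ideal.**
On `ℤ[x₀, x₁, x₂]` with the step `s = ({x₀, x₁}, ζ = x₀)` and `E' = {x₀x₂ − x₁², x₂ − x₁}`:
`Ideal.span {(s.properTransform B).toPoly | B ∈ E'} ≠ s.strictTransform (Ideal.span (toPoly '' E'))`.
[cite: Hu2025, Def. 5.4, p. 80 (unrefereed preprint arXiv:2507.21400v1 under adjudication, D-0012/D-0089 — OURS toy on the typed vocabulary of row 106a; nothing of the source asserted)] -/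
theorem exists_span_properTransform_ne_strictTransform :
    ∃ (s : ChartStep (Fin 3)) (E' : Set (Binomial (Fin 3))),
      Ideal.span ((fun B => (s.properTransform B).toPoly (R := ℤ)) '' E') ≠
        s.strictTransform (R := ℤ) (Ideal.span ((fun B => B.toPoly (R := ℤ)) '' E')) := by
  classical
  -- the step: centre {a, b} = {0, 1}, exceptional variable ζ = a = x₀ (so b ↦ a·b)
  let s : ChartStep (Fin 3) := ⟨{0, 1}, 0, by simp⟩
  -- B₁ = a t − b², B₂ = t − b
  let B₁ : Binomial (Fin 3) := ⟨Finsupp.single 0 1 + Finsupp.single 2 1, Finsupp.single 1 2⟩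
  let B₂ : Binomial (Fin 3) := ⟨Finsupp.single 2 1, Finsupp.single 1 1⟩
  refine ⟨s, {B₁, B₂}, fun h => ?_⟩
  -- the term-wise transforms, on exponents
  have herase : s.centre.erase s.exc = {1} := by decide
  have hT₁ : s.properTransform B₁ = ⟨Finsupp.single 2 1, Finsupp.single 0 1 + Finsupp.single 1 2⟩ := by
    simp only [ChartStep.properTransform, ChartStep.pullbackExp, herase, Finset.sum_singleton, lPhi, phiDeg, Binomial.mk.injEq,
      B₁, s]
    constructor
    · ext i; fin_cases i <;> simp [Finsupp.single_apply]
    · ext i; fin_cases i <;> simp [Finsupp.single_apply]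
  have hT₂ : s.properTransform B₂ = ⟨Finsupp.single 2 1, Finsupp.single 0 1 + Finsupp.single 1 1⟩ := by
    simp only [ChartStep.properTransform, ChartStep.pullbackExp, herase, Finset.sum_singleton, lPhi, phiDeg, Binomial.mk.injEq,
      B₂, s]
    constructor
    · ext i; fin_cases i <;> simp [Finsupp.single_apply]
    · ext i; fin_cases i <;> simp [Finsupp.single_apply]
  -- as polynomials: t − a b² and t − a b ; B₁ = a t − b², B₂ = t − b
  have hP₁ : (s.properTransform B₁).toPoly (R := ℤ) = X 2 - X 0 * X 1 ^ 2 := by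
    rw [hT₁]
    simp only [Binomial.toPoly, X, monomial_mul, monomial_pow, mul_one, one_pow, Finsupp.smul_single, smul_eq_mul]
  have hP₂ : (s.properTransform B₂).toPoly (R := ℤ) = X 2 - X 0 * X 1 := by
    rw [hT₂]
    simp only [Binomial.toPoly, X, monomial_mul, mul_one]
  have hB₁ : B₁.toPoly (R := ℤ) = X 0 * X 2 - X 1 ^ 2 := by
    simp only [Binomial.toPoly, B₁, X, monomial_mul, monomial_pow, mul_one, one_pow, Finsupp.smul_single, smul_eq_mul]
  have hB₂ : B₂.toPoly (R := ℤ) = X 2 - X 1 := by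
    simp only [Binomial.toPoly, B₂, X]
  have himg : ((fun B => (s.properTransform B).toPoly (R := ℤ)) '' {B₁, B₂}) =
      {(X 2 - X 0 * X 1 ^ 2 : MvPolynomial (Fin 3) ℤ), X 2 - X 0 * X 1} := by
    rw [Set.image_pair, hP₁, hP₂]
  have himg' : ((fun B => B.toPoly (R := ℤ)) '' {B₁, B₂}) = {(X 0 * X 2 - X 1 ^ 2 : MvPolynomial (Fin 3) ℤ), X 2 - X 1} := by
    rw [Set.image_pair, hB₁, hB₂]
  rw [himg, himg'] at h
  -- `b − b²` lies in the strict transform: `a² (b − b²) = π^*(B₁ − a B₂)`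
  have hpa : s.pullback (R := ℤ) (X 0) = X 0 := s.pullback_X_exc
  have hpb : s.pullback (R := ℤ) (X 1) = X 0 * X 1 := s.pullback_X_of_mem (by decide) (by decide)
  have hpt : s.pullback (R := ℤ) (X 2) = X 2 := s.pullback_X_of_not_mem (by decide)
  have hmem : (X 1 - X 1 ^ 2 : MvPolynomial (Fin 3) ℤ) ∈
      s.strictTransform (R := ℤ) (Ideal.span {(X 0 * X 2 - X 1 ^ 2 : MvPolynomial (Fin 3) ℤ), X 2 - X 1}) := by
    unfold ChartStep.strictTransform
    refine Ideal.mem_iSup_of_mem 2 ?_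
    rw [Submodule.mem_colon_singleton, smul_eq_mul, ChartStep.excVar_eq]
    have h1 : s.pullback (R := ℤ) (X 0 * X 2 - X 1 ^ 2 - X 0 * (X 2 - X 1)) ∈
        (Ideal.span {(X 0 * X 2 - X 1 ^ 2 : MvPolynomial (Fin 3) ℤ), X 2 - X 1}).map (s.pullback (R := ℤ)) :=
      Ideal.mem_map_of_mem _ (Ideal.sub_mem _ (Ideal.subset_span (by simp))
        (Ideal.mul_mem_left _ _ (Ideal.subset_span (by simp))))
    have hcalc : s.pullback (R := ℤ) (X 0 * X 2 - X 1 ^ 2 - X 0 * (X 2 - X 1)) = (X 1 - X 1 ^ 2) * X s.exc ^ 2 := by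
      simp only [map_sub, map_mul, map_pow, hpa, hpb, hpt]
      show _ = (X 1 - X 1 ^ 2) * X 0 ^ 2
      ring
    rw [hcalc] at h1
    exact h1
  -- … but not in the ideal of the term-wise transforms: evaluate at a = t = 0, b = 2
  rw [← h] at hmem
  rw [Ideal.mem_span_pair] at hmem
  obtain ⟨u, v, huv⟩ := hmem
  have := congrArg (MvPolynomial.eval ![(0 : ℤ), 2, 0]) huv
  simp at this

end GH2Toy

end Literature.AlgebraicGeometry.Hu2025.Statements.S05ThetaBlowups

end
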